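import Summits.QuantumFields.BalabanUV.T4Continuum.Spine.NE3.AvgKernelGaugeDecomposition
import Summits.QuantumFields.BalabanUV.T4Continuum.Support.NE3ClassSlicePoincare
import Summits.QuantumFields.BalabanUV.T4Continuum.Support.NE3HatInvCurlLetters
import HarnessLib

/-!
# T⁴ programme, node NE3 — census R42 (b): THE CURVED SLICE POINCARÉ INEQUALITY (P♮)_W TRANSFERS, FOR FREE, FROM THE OWNER SWARM's FRAME-FREE
# SLICE `T_♮(W)` TO THE COULOMB SLICE OF B8's RESTRICTED GAUGE ALGEBRA `N(Q′(W))` — and therefore HOLDS ON THAT SLICE OVER BAŁABAN's CLASS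

Cell `pub-balaban-gaps` (YM blitz, track G2, seat `ne3`, unit `pub-balaban-gaps-ne3-g10`; writer prover-pub-balaban-gaps-ne3-g10-0, 2026-08-25), census
`run/shared/lean/pub/pub-balaban-gaps/ne/NE3.md` §4 R42 ∕ §16.  WHAT.  The `N(Q′(W))`-COULOMB SLICE at level `k`, period `N·L^k`, background `W`, is the
direction set (written INLINE below, no `def`):

  `𝒞_N(W) := {Y | IsSkewDir Y ∧ IsPeriodicDir Y (N·L^k) ∧ QbarIter L k W Y = 0 ∧ ∀ μ ∈ avgKernelGauges L N k W, Σ_{periodBox (N·L^k)} Σ_κ hsR (Y x κ) (gaugeDir W μ x κ) = 0}`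

— the kernel of the k-fold linearised double-bar average, gauge-fixed by `hsR`-ORTHOGONALITY to the gauge directions of B8's restricted algebra
`N(Q′(W))` (skew periodic generators with NESTED TRANSPORTED BLOCK MEAN ZERO, `Spine/NE3/PairLandauB8.avgKernelGauges`); it differs from B8's own slice
`slicB8` ((1.38): orthogonality to `gaugeDir W (Δ_W N(Q′(W)))`) only in the weight `Δ_W`.  By `AvgKernelGaugeDecomposition` (R42 (a)) the ambient space
`ker QbarIter ∩ {skew, periodic}` is `T_♮(W) + gaugeDir W (N(Q′(W)))`, and `𝒞_N(W)` is its MIN-NORM section: `Y ⊥ gaugeDir W λ` (Pythagoras in the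
normalised Hilbert–Schmidt currency).  Hence the TRANSFER (§2): for `Y ∈ 𝒞_N(W)` with `X = Y + gaugeDir W λ ∈ T_♮(W)`, `λ ∈ N(Q′(W))`:
`Σ nhs Y ≤ Σ nhs X`, `Σ nhs (gaugeDir W λ) ≤ Σ nhs X`; K6-Ξ's Poincaré inequality on `N(Q′(W))` (`NE3CornerGaugePoincare`, `Σ nhs λ ≤ 4M²·Σ nhs (gaugeDir W λ)`)
and the plaquette-commutator bound `curlSq_W (gaugeDir W λ) ≤ 4x²·#planes·Σ‖λ‖²` (`NE3CurlOfGaugeDir`) give `curlSq_W X ≤ 2·curlSq_W Y + 32·#planes·card n·x²M²·dirSq X`;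
(P♮) on `T_♮(W)` with constant `C` turns the last term into `32·#planes·card n·C·(x·M²)²·curlSq_W X`, absorbed under the ONE displayed smallness
`64·#planes·card n·C·(M²x)² ≤ 1`; so `curlSq_W X ≤ 4·curlSq_W Y` and `M⁻²·dirSq Y ≤ card n·M⁻²·dirSq X ≤ 4·card n·C·curlSq_W Y`.

CONTENT (0 sorry, no `def`; [folklore]): §1 `CPLine_nonneg`; §2 **`slicePoincare_coulombN_of_frameFree`** — at every unitary
`(N·L^{j+1})`-periodic background of the tower's small-field class (K6-Ξ's displayed smallness `hsmall`), (P♮) on `T_♮(W)` with constant `C` and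
`64·#planes·card n·C·((L^{j+1})²x)² ≤ 1` imply (P♮) on `𝒞_N(W)` with constant `4·card n·C`; §3 **`classSlicePoincare_coulombN_of_lines`** — OVER BAŁABAN's CLASS:
under the hypotheses of `NE3ClassSlicePoincare.classSlicePoincare_of_lines` (class radius `0 < ε ≤ θ`, K1 cut `εc`, row Y9's family, the four k-free lines)
and ONE more k-free line `64·#planes·card n·CPLine·ε² ≤ 1`:
`∀ j W, W ∈ sfClass d L N ε (j+1) → SlicePoincare L (j+1) W 𝒞_N(W) (4·card n·CPLine d L (card n) εc θ) (periodBox (N·L^{j+1}))` — THE CURVED (P♮) ON A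
LANDAU-TYPE SLICE OF `ker QbarIter`, k-FREE, N-FREE, from the owner swarm's K-rows BY NAME.

WHY IT MATTERS (census R42).  THE END's last [B9]-§3-TYPE binder is `hP` = (P♮) on `slicB8(W)`; `slicB8(W)` and `𝒞_N(W)` are two Landau-type complements of
the SAME sub-orbit `gaugeDir W (N(Q′(W)))` in the SAME space; re-basing THE END's supplier on `𝒞_N(W)` needs only the `N(Q′(W))`-Coulomb projection, whose sup
letter is (H0_W) ALONE (gens 8–9, `SupRegularityCurvedUniform`) — see the census for the located programme; the transfer `𝒞_N(W) → slicB8(W)` itself is NOT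
claimed here.

HONEST FRAMING.  Linear algebra + two landed kinematic inequalities over the owner swarm's PROVED curved (P♮) on `T_♮(W)`; the constants are theirs (honest,
astronomical: `CPLine ≈ 10¹⁷` at `d = 4`); nothing of Bałaban's asserted; (P♮) on `slicB8`, `PairLandauGaugeB8Avg`, (H3ˢᵘᵖ), the covariant root and **NE3 are
NOT proved**; spine PROVED 0∕9; finite T⁴ rung (B)+1 — NOT continuum YM on ℝ⁴, NOT infinite volume, NOT mass gap, NOT Clay.  PLACEMENT:
`Summits/QuantumFields/BalabanUV/T4Continuum/Spine/NE3/`; imports accepted modules only; moves nothing.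
-/

set_option autoImplicit false

open scoped BigOperators Matrix Matrix.Norms.L2Operator
open Finset

namespace Summit.QuantumFields.BalabanUV.T4Continuum.NE3.SlicePoincareCoulombN

open Literature.MathematicalPhysics.QuantumFieldTheory.Balaban1983to89
open B7Prop1Explicit B7Prop2Explicit MatrixNorms
open T4AveragingDeficitWall (IsUnitaryCfg IsSkewDir SmallField Ad Plane curl curlSq dirSq)
open T4AveragingDeficitWallBoundary (IsPeriodicCfg periodBox mem_periodBox)
open AveragingDeficitPeriodicCounting (IsPeriodicDir)
open AveragingDeficitTwoLevelPrep (prop1Radius)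
open AveragingDeficitMultiLevelPrep (tower LevelSmall)
open SpreadLift (loopRad)
open BlockAveragePushDirGauge (gaugeDir)
open NE3TangentCovariantTower (QbarIter)
open NE3CovariantCalculus (hsR nhsNormSq_sub)
open NE3LandauOrbit (nhsNormSq_add)
open NE3CovariantBlockMean (bmeanIterW)
open NE3CornerGaugePoincare (sum_nhsNormSq_le_four_mul_of_bmeanIterW_eq_zero)
open NE3CurlOfGaugeDir (curlSq_gaugeDir_le)
open NE3HatInvCurlLetters (curlSq_add_le)
open NE3CovariantLineSumsError (sq_mul_le_prop1Radius)
open NE3FrameFreeSliceW (frameFreeBlockLandauW)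
open NE3SlicePoincareShape (SlicePoincare slicePoincare_mono)
open NE3EnergyRateWSupOfSlicePoincare (tower_eq_mul_pow)
open NE3SlicePoincareBudgetLine (CPLine ShLine SmallYLine ALine KhLine gTop bhTop cfTop qTop cjTop lrTop wTop)
open NE3CovariantLineSumsL2 (C2sq)
open NE3ClassSlicePoincare (xi_of_line classSlicePoincare_of_lines)
open NE3CovariantLineSumsL2Tower (rho)
open MinimalActionRate (sfClass)
open NE3.PairLandauB8 (avgKernelGauges mem_avgKernelGauges_iff)
open NE3.AvgKernelGaugeDecomposition (exists_avgKernelGauge_mem_frameFreeBlockLandauW)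

noncomputable section

variable {d : ℕ} {n : Type*} [Fintype n] [DecidableEq n]

/-! ## §1 Nonnegativity of the owner's slice constant -/

/-- The owner swarm's k-free slice constant `CPLine d L c ε θ` is nonnegative (`1 ≤ d`, `0 ≤ c, ε, θ`). [folklore] -/
theorem CPLine_nonneg (hd : 1 ≤ d) (L : ℕ) {c ε θ : ℝ} (hc : 0 ≤ c) (hε : 0 ≤ ε) (hθ : 0 ≤ θ) : 0 ≤ CPLine d L c ε θ := by
  have hd1 : (1 : ℝ) ≤ d := by exact_mod_cast hd
  have hdm : 0 ≤ (d : ℝ) - 1 := by linarith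
  have hlr : 0 ≤ lrTop d θ := by unfold lrTop; positivity
  have hcf : 0 ≤ cfTop d θ := by
    unfold cfTop; have := mul_nonneg hdm hθ; positivity
  have hq : 0 ≤ qTop d θ := by unfold qTop; positivity
  have hg : 0 ≤ gTop d c θ := by unfold gTop; positivity
  have hbh : 0 ≤ bhTop d L c θ := by unfold bhTop; positivity
  have hA : 0 ≤ ALine d c ε θ := by unfold ALine; positivity
  have hK : 0 ≤ KhLine d L c ε θ := by unfold KhLine; positivity
  unfold CPLine; positivity

/-! ## §2 The transfer `T_♮(W) → 𝒞_N(W)` at one background of the class -/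

/-- **(P♮)_W TRANSFERS FROM `T_♮(W)` TO THE `N(Q′(W))`-COULOMB SLICE** (`1 ≤ d`, `2 ≤ L`, `N ≥ 1`; unitary `W` of period `N·L^{j+1}` in the tower's
small-field class — `0 ≤ x`, `LevelSmall d L j x`, `SmallField W x` — with K6-Ξ's displayed smallness `hsmall`): if (P♮) holds on
`frameFreeBlockLandauW L N (j+1) W` with constant `C ≥ 0` and `64·#planes·card n·C·((L^{j+1})²·x)² ≤ 1`, then (P♮) holds on
`{Y | skew ∧ periodic ∧ QbarIter L (j+1) W Y = 0 ∧ Y ⊥ gaugeDir W (avgKernelGauges L N (j+1) W)}` with constant `4·card n·C`. [folklore] -/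
theorem slicePoincare_coulombN_of_frameFree [Nonempty n] (hd : 1 ≤ d) {L N : ℕ} [NeZero N] (hL : 2 ≤ L) (j : ℕ)
    {W : Site d → Fin d → (Matrix n n ℂ)ˣ} {x : ℝ} (hWu : IsUnitaryCfg W) (hWP : IsPeriodicCfg W ((N * L ^ (j + 1) : ℕ) : ℤ))
    (hx : 0 ≤ x) (hs : LevelSmall d L j x) (hWx : SmallField W x)
    (hsmall : 8 * d * (((L : ℝ) ^ (j + 1)) * (((d : ℝ) - 1) * (((L : ℝ) ^ (j + 1)) - 1) * x)) ^ 2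
      + 2 * (Fintype.card n * (4 * (d : ℝ) ^ 2 * ((L : ℝ) ^ (j + 1) - 1) ^ 2 * x + 16 * d * loopRad d L ((prop1Radius d L)^[j] x)) ^ 2)
        ≤ 1 / 2)
    {C : ℝ} (hC : 0 ≤ C)
    (hP : SlicePoincare L (j + 1) W (frameFreeBlockLandauW (d := d) (n := n) L N (j + 1) W) C (periodBox (d := d) (N * L ^ (j + 1))))
    (hθ : 64 * (Fintype.card (Plane d) : ℝ) * (Fintype.card n : ℝ) * C * (((L : ℝ) ^ (j + 1)) ^ 2 * x) ^ 2 ≤ 1) :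
    SlicePoincare L (j + 1) W
      {Y | IsSkewDir Y ∧ IsPeriodicDir Y ((N * L ^ (j + 1) : ℕ) : ℤ) ∧ (QbarIter L (j + 1) W Y = fun _ _ => 0) ∧
        ∀ μ ∈ avgKernelGauges (d := d) (n := n) L N (j + 1) W,
          ∑ x ∈ periodBox (d := d) (N * L ^ (j + 1)), ∑ κ : Fin d, hsR (Y x κ) (gaugeDir W μ x κ) = 0}
      (4 * (Fintype.card n : ℝ) * C) (periodBox (d := d) (N * L ^ (j + 1))) := by
  intro Y hY
  obtain ⟨hYs, hYP, hQ, horth⟩ := hY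
  have hL1 : 1 ≤ L := by omega
  have hLd : 2 ≤ L ^ d := by
    calc 2 ≤ L := hL
      _ = L ^ 1 := (pow_one L).symm
      _ ≤ L ^ d := Nat.pow_le_pow_right (by omega) hd
  have hM0 : (0 : ℝ) < (L : ℝ) ^ (j + 1) := by positivity
  -- the decomposition `X = Y + gaugeDir W λ ∈ T_♮(W)`, `λ ∈ N(Q′(W))`
  obtain ⟨lam, hlamN, -, hX⟩ := exists_avgKernelGauge_mem_frameFreeBlockLandauW hL1 hLd j hWu hWP hx hs hWx hYs hYP hQ
  obtain ⟨-, -, hlam0⟩ := mem_avgKernelGauges_iff.mp hlamN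
  obtain ⟨F, hF⟩ : ∃ F : Finset (Site d), F = periodBox (d := d) (N * L ^ (j + 1)) := ⟨_, rfl⟩
  obtain ⟨X, hXdef⟩ : ∃ X : Site d → Fin d → Matrix n n ℂ, X = Y + gaugeDir W lam := ⟨_, rfl⟩
  have hXmem : X ∈ frameFreeBlockLandauW (d := d) (n := n) L N (j + 1) W := by rw [hXdef]; exact hX
  -- the three Hilbert–Schmidt masses
  obtain ⟨SY, hSY⟩ : ∃ S : ℝ, S = ∑ y ∈ F, ∑ κ : Fin d, nhsNormSq (Y y κ) := ⟨_, rfl⟩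
  obtain ⟨SG, hSG⟩ : ∃ S : ℝ, S = ∑ y ∈ F, ∑ κ : Fin d, nhsNormSq (gaugeDir W lam y κ) := ⟨_, rfl⟩
  obtain ⟨SX, hSX⟩ : ∃ S : ℝ, S = ∑ y ∈ F, ∑ κ : Fin d, nhsNormSq (X y κ) := ⟨_, rfl⟩
  have hSY0 : 0 ≤ SY := by rw [hSY]; exact sum_nonneg fun _ _ => sum_nonneg fun _ _ => nhsNormSq_nonneg _
  have hSG0 : 0 ≤ SG := by rw [hSG]; exact sum_nonneg fun _ _ => sum_nonneg fun _ _ => nhsNormSq_nonneg _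
  -- (1) Pythagoras: `SX = SY + SG` (the Coulomb clause against `λ ∈ N(Q′(W))`)
  have hPyth : SX = SY + SG := by
    have h0 : ∑ y ∈ F, ∑ κ : Fin d, hsR (Y y κ) (gaugeDir W lam y κ) = 0 := by rw [hF]; exact horth lam hlamN
    rw [hSX, hSY, hSG, hXdef]
    simp only [Pi.add_apply, nhsNormSq_add, sum_add_distrib, ← mul_sum, h0, mul_zero, add_zero]
  have hSYX : SY ≤ SX := by rw [hPyth]; linarith
  have hSGX : SG ≤ SX := by rw [hPyth]; linarith
  -- (2) `SX ≤ dirSq X F`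
  have hSXdir : SX ≤ dirSq X F := by
    rw [hSX]; unfold dirSq
    exact sum_le_sum fun y _ => sum_le_sum fun κ _ => nhsNormSq_le_opNorm_sq _
  -- (3) K6-Ξ's Poincaré inequality on `N(Q′(W))`
  have hPoinc : ∑ y ∈ F, nhsNormSq (lam y) ≤ 4 * (((L : ℝ) ^ (j + 1)) ^ 2 * SG) := by
    have hF' : F = periodBox (d := d) (L ^ (j + 1) * N) := by rw [hF, Nat.mul_comm]
    have h := sum_nhsNormSq_le_four_mul_of_bmeanIterW_eq_zero hL j hWu hx hs hWx N lam
      (fun z _ => by rw [hlam0]; rfl) hsmall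
    rw [hSG, hF']
    exact h
  -- (4) the curl of the gauge direction: plaquette commutator × Poincaré
  have hcurlG : curlSq W (gaugeDir W lam) F
      ≤ 16 * (Fintype.card (Plane d) : ℝ) * (Fintype.card n : ℝ) * x ^ 2 * ((L : ℝ) ^ (j + 1)) ^ 2 * SG := by
    have h1 := curlSq_gaugeDir_le hWu hWx lam F
    have h2 : ∑ z ∈ F, ‖lam z‖ ^ 2 ≤ (Fintype.card n : ℝ) * ∑ z ∈ F, nhsNormSq (lam z) := by
      rw [mul_sum]; exact sum_le_sum fun z _ => opNorm_sq_le_card_mul_nhsNormSq _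
    have hP0 : (0 : ℝ) ≤ 4 * x ^ 2 * (Fintype.card (Plane d) : ℝ) := by positivity
    calc curlSq W (gaugeDir W lam) F ≤ 4 * x ^ 2 * (Fintype.card (Plane d) : ℝ) * ∑ z ∈ F, ‖lam z‖ ^ 2 := h1
      _ ≤ 4 * x ^ 2 * (Fintype.card (Plane d) : ℝ) * ((Fintype.card n : ℝ) * (4 * (((L : ℝ) ^ (j + 1)) ^ 2 * SG))) :=
          mul_le_mul_of_nonneg_left (h2.trans (mul_le_mul_of_nonneg_left hPoinc (by positivity))) hP0
      _ = 16 * (Fintype.card (Plane d) : ℝ) * (Fintype.card n : ℝ) * x ^ 2 * ((L : ℝ) ^ (j + 1)) ^ 2 * SG := by ring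
  -- (5) (P♮) on `T_♮(W)` for `X`: `dirSq X ≤ M²·C·curlSq X`
  have hPX : dirSq X F ≤ ((L : ℝ) ^ (j + 1)) ^ 2 * (C * curlSq W X F) := by
    have h := hP X hXmem
    rw [← hF, inv_pow, inv_mul_le_iff₀ (by positivity)] at h
    exact h
  -- (6) absorb: `curlSq X ≤ 2·curlSq Y + 32·#pl·card n·x²M²·SX ≤ 2·curlSq Y + ½·curlSq X`
  have hcurlX0 : 0 ≤ curlSq W X F := by unfold curlSq; positivity
  have hcurlX : curlSq W X F ≤ 4 * curlSq W Y F := by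
    have h1 : curlSq W X F ≤ 2 * curlSq W Y F + 2 * curlSq W (gaugeDir W lam) F := by
      rw [hXdef]; exact curlSq_add_le W Y (gaugeDir W lam) F
    have h2 : 2 * curlSq W (gaugeDir W lam) F
        ≤ 32 * (Fintype.card (Plane d) : ℝ) * (Fintype.card n : ℝ) * x ^ 2 * ((L : ℝ) ^ (j + 1)) ^ 2 * SX := by
      have := mul_le_mul_of_nonneg_left hSGX
        (show (0 : ℝ) ≤ 32 * (Fintype.card (Plane d) : ℝ) * (Fintype.card n : ℝ) * x ^ 2 * ((L : ℝ) ^ (j + 1)) ^ 2 by positivity)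
      linarith [hcurlG, this]
    have h3 : 32 * (Fintype.card (Plane d) : ℝ) * (Fintype.card n : ℝ) * x ^ 2 * ((L : ℝ) ^ (j + 1)) ^ 2 * SX
        ≤ (32 * (Fintype.card (Plane d) : ℝ) * (Fintype.card n : ℝ) * C * (((L : ℝ) ^ (j + 1)) ^ 2 * x) ^ 2) * curlSq W X F := by
      have := mul_le_mul_of_nonneg_left (hSXdir.trans hPX)
        (show (0 : ℝ) ≤ 32 * (Fintype.card (Plane d) : ℝ) * (Fintype.card n : ℝ) * x ^ 2 * ((L : ℝ) ^ (j + 1)) ^ 2 by positivity)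
      calc 32 * (Fintype.card (Plane d) : ℝ) * (Fintype.card n : ℝ) * x ^ 2 * ((L : ℝ) ^ (j + 1)) ^ 2 * SX
          ≤ 32 * (Fintype.card (Plane d) : ℝ) * (Fintype.card n : ℝ) * x ^ 2 * ((L : ℝ) ^ (j + 1)) ^ 2
              * (((L : ℝ) ^ (j + 1)) ^ 2 * (C * curlSq W X F)) := this
        _ = (32 * (Fintype.card (Plane d) : ℝ) * (Fintype.card n : ℝ) * C * (((L : ℝ) ^ (j + 1)) ^ 2 * x) ^ 2) * curlSq W X F := by
              ring
    have h4 : (32 * (Fintype.card (Plane d) : ℝ) * (Fintype.card n : ℝ) * C * (((L : ℝ) ^ (j + 1)) ^ 2 * x) ^ 2) * curlSq W X F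
        ≤ (1 / 2) * curlSq W X F := by
      refine mul_le_mul_of_nonneg_right ?_ hcurlX0
      linarith
    linarith
  -- (7) assemble
  have hdirY : dirSq Y F ≤ (Fintype.card n : ℝ) * SY := by
    rw [hSY, mul_sum]; unfold dirSq
    refine sum_le_sum fun y _ => ?_
    rw [mul_sum]
    exact sum_le_sum fun κ _ => opNorm_sq_le_card_mul_nhsNormSq _
  have hcn0 : (0 : ℝ) ≤ (Fintype.card n : ℝ) := by positivity
  have hchain : dirSq Y F ≤ (Fintype.card n : ℝ) * (((L : ℝ) ^ (j + 1)) ^ 2 * (C * (4 * curlSq W Y F))) := by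
    calc dirSq Y F ≤ (Fintype.card n : ℝ) * SY := hdirY
      _ ≤ (Fintype.card n : ℝ) * SX := mul_le_mul_of_nonneg_left hSYX hcn0
      _ ≤ (Fintype.card n : ℝ) * dirSq X F := mul_le_mul_of_nonneg_left hSXdir hcn0
      _ ≤ (Fintype.card n : ℝ) * (((L : ℝ) ^ (j + 1)) ^ 2 * (C * curlSq W X F)) := mul_le_mul_of_nonneg_left hPX hcn0
      _ ≤ (Fintype.card n : ℝ) * (((L : ℝ) ^ (j + 1)) ^ 2 * (C * (4 * curlSq W Y F))) :=
          mul_le_mul_of_nonneg_left (mul_le_mul_of_nonneg_left (mul_le_mul_of_nonneg_left hcurlX hC) (by positivity)) hcn0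
  rw [← hF, inv_pow, inv_mul_le_iff₀ (by positivity)]
  calc dirSq Y F ≤ (Fintype.card n : ℝ) * (((L : ℝ) ^ (j + 1)) ^ 2 * (C * (4 * curlSq W Y F))) := hchain
    _ = ((L : ℝ) ^ (j + 1)) ^ 2 * (4 * (Fintype.card n : ℝ) * C * curlSq W Y F) := by ring

/-! ## §3 Over Bałaban's class: the curved (P♮) on the `N(Q′(W))`-Coulomb slice, k-free -/

/-- **(P♮)_W ON THE `N(Q′(W))`-COULOMB SLICE, UNIFORMLY OVER THE SMALL-FIELD CLASS** (`3 ≤ d`, `2 ≤ L`, `1 ≤ N`; class radius `0 < ε ≤ θ`, K1 cut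
`0 < εc`, row Y9's family, the four k-free lines of `NE3ClassSlicePoincare.classSlicePoincare_of_lines`, and the transfer line
`64·#planes·card n·CPLine d L (card n) εc θ·ε² ≤ 1`):
`∀ j W, W ∈ sfClass d L N ε (j+1) → SlicePoincare L (j+1) W 𝒞_N(W) (4·card n·CPLine d L (card n) εc θ) (periodBox (N·L^{j+1}))`. [folklore] -/
theorem classSlicePoincare_coulombN_of_lines [Nonempty n] (hd : 3 ≤ d) {L N : ℕ} (hL : 2 ≤ L) (hN : 1 ≤ N) {ε θ εc : ℝ}
    (hε : 0 < ε) (hεθ : ε ≤ θ) (hεc : 0 < εc)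
    (hsmall : ∀ j : ℕ, LevelSmall d L (j + 1) (ε / ((L : ℝ) ^ (j + 2)) ^ 2))
    (h1 : ShLine d L (Fintype.card n) εc θ ≤ 1 / 2) (h2 : SmallYLine d L (Fintype.card n) εc θ ≤ 1 / 2)
    (h3 : 68 / 3 * (((d : ℝ) + 1) * ((d : ℝ) + 4)) * C2sq d L * θ ≤ rho d L / 2)
    (h4 : 8 * d * (((d : ℝ) - 1) * θ) ^ 2
      + 2 * ((Fintype.card n : ℝ) * ((4 * (d : ℝ) ^ 2 + 272 * d * (((d : ℝ) + 1) * ((d : ℝ) + 4))) * θ) ^ 2) ≤ 1 / 2)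
    (h5 : 64 * (Fintype.card (Plane d) : ℝ) * (Fintype.card n : ℝ) * CPLine d L (Fintype.card n) εc θ * ε ^ 2 ≤ 1) :
    ∀ j : ℕ, ∀ W : Site d → Fin d → (Matrix n n ℂ)ˣ, W ∈ sfClass d L N ε (j + 1) →
      SlicePoincare L (j + 1) W
        {Y | IsSkewDir Y ∧ IsPeriodicDir Y ((N * L ^ (j + 1) : ℕ) : ℤ) ∧ (QbarIter L (j + 1) W Y = fun _ _ => 0) ∧
          ∀ μ ∈ avgKernelGauges (d := d) (n := n) L N (j + 1) W,
            ∑ x ∈ periodBox (d := d) (N * L ^ (j + 1)), ∑ κ : Fin d, hsR (Y x κ) (gaugeDir W μ x κ) = 0}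
        (4 * (Fintype.card n : ℝ) * CPLine d L (Fintype.card n) εc θ) (periodBox (d := d) (N * L ^ (j + 1))) := by
  intro j W hW
  haveI : NeZero N := ⟨by omega⟩
  have hPcls := classSlicePoincare_of_lines (n := n) hd hL hN hε hεθ hεc hsmall h1 h2 h3 h4 j W hW
  obtain ⟨hWu, hWP, hWx⟩ := hW
  have hd1 : 1 ≤ d := by omega
  have hL0 : (0 : ℝ) < L := by exact_mod_cast (show 0 < L by omega)
  -- the level radius `x_j = ε∕(L^{j+1})²`
  have hx : 0 ≤ ε / ((L : ℝ) ^ (j + 1)) ^ 2 := by positivity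
  have hθ' : ((L : ℝ) ^ (j + 1)) ^ 2 * (ε / ((L : ℝ) ^ (j + 1)) ^ 2) ≤ θ := by
    have e : ((L : ℝ) ^ (j + 1)) ^ 2 * (ε / ((L : ℝ) ^ (j + 1)) ^ 2) = ε := by field_simp
    rw [e]; exact hεθ
  have hs : LevelSmall d L j (ε / ((L : ℝ) ^ (j + 1)) ^ 2) := by
    have hy : 0 ≤ ε / ((L : ℝ) ^ (j + 2)) ^ 2 := by positivity
    have hxy : ε / ((L : ℝ) ^ (j + 1)) ^ 2 ≤ prop1Radius d L (ε / ((L : ℝ) ^ (j + 2)) ^ 2) := by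
      have e : ε / ((L : ℝ) ^ (j + 1)) ^ 2 = (L : ℝ) ^ 2 * (ε / ((L : ℝ) ^ (j + 2)) ^ 2) := by
        field_simp; ring
      rw [e]; exact sq_mul_le_prop1Radius (d := d) L _
    exact AveragingDeficitMultiLevelPrep.LevelSmall.mono (d := d) hx hxy (hsmall j).2
  have hxi := xi_of_line (c := Fintype.card n) hd1 hL j hx hs hθ' h4
  -- the constant is nonnegative (it dominates a Poincaré quotient; here read off `CPLine`'s definition is not needed: use `h5`)
  have hCP0 : 0 ≤ CPLine d L (Fintype.card n) εc θ :=
    CPLine_nonneg hd1 L (by positivity) hεc.le (hε.le.trans hεθ)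
  have hθline : 64 * (Fintype.card (Plane d) : ℝ) * (Fintype.card n : ℝ) * CPLine d L (Fintype.card n) εc θ
      * (((L : ℝ) ^ (j + 1)) ^ 2 * (ε / ((L : ℝ) ^ (j + 1)) ^ 2)) ^ 2 ≤ 1 := by
    have e : ((L : ℝ) ^ (j + 1)) ^ 2 * (ε / ((L : ℝ) ^ (j + 1)) ^ 2) = ε := by field_simp
    rw [e]; exact h5
  exact slicePoincare_coulombN_of_frameFree hd1 hL j hWu hWP hx hs hWx hxi hCP0 hPcls hθline

end

end Summit.QuantumFields.BalabanUV.T4Continuum.NE3.SlicePoincareCoulombN
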